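import Mathlib
import HarnessLib
import Literature.Analysis.FluidPDE.VectorCalculus
import Literature.Analysis.FluidPDE.PressurePoisson
import Literature.Analysis.FluidPDE.LerayProfileCalculus
import Literature.Analysis.FluidPDE.TaoEnstrophyLocalisationProofs
import Literature.Analysis.FluidPDE.HarmonicLiouvilleLp
import Literature.Analysis.FluidPDE.NSLocalLerayBackwardUniqueness
import Literature.Analysis.FluidPDE.TypeIAncientMildClassical
import Summits.NavierStokesRegularity.NavierStokesRegularity.Theorems.LocalTraceTubeDoorHarmonicOscillation
import Summits.NavierStokesRegularity.NavierStokesRegularity.Theorems.LocalHelicityTubeDoorFrobeniusProfileRigidityBernoulli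
import Summits.NavierStokesRegularity.NavierStokesRegularity.Theorems.LocalHelicityTubeDoorFrobeniusWindowRigidityWindow
import Summits.NavierStokesRegularity.NavierStokesRegularity.Theorems.LocalSineTubeDoorProfileAlignedWindowRigidityAncient
import Summits.NavierStokesRegularity.NavierStokesRegularity.Theorems.PoloidalWindowDoorPoloidalWindowRigidityWindow
import Summits.NavierStokesRegularity.NavierStokesRegularity.Theorems.PoloidalWindowDoorPoloidalWindowRigidityFlat
import Summits.NavierStokesRegularity.NavierStokesRegularity.Theorems.PoloidalWindowDoorPoloidalWindowRigidityPressureOscillation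

/-!
# The one-window door family — the HARMONIC-HEAD («Lamb-divergence») profile crux:
# Type-I profiles whose Bernoulli head is HARMONIC on a window of every slice are trivial

Cell ns-regularity-ideate, seat p6 (route-directed support for nsreg-p1's door family; bears_on LADDER-NS N0; anchor
`--supports stmt-NavierStokesRegularity-20018`, the profile-rigidity item of the family).  Sequel of door S14
(`…LocalTraceTubeDoorProfileRigidity`: harmonic PRESSURE ⇒ trivial) and of the Bernoulli stratum of
ns-helicity-19975-w1 (`…FrobeniusProfileRigidityBernoulli.eq_zero_of_head_streamline`: head constant along
streamlines ⇒ trivial).  For a classical solution `(u, p)` the Laplacian of the Bernoulli head `Π = p + |u|²/2` is the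
SECOND-ORDER, PRESSURE-FREE scalar `ΔΠ = ⟪u, Δu⟫ + |curl u|²` (`= div (u × ω)`, the divergence of the Lamb vector;
pressure Poisson `Δp = −tr((Du)²)`, `Δ|u|² = 2⟪Δu,u⟫ + 2|Du|²_F`, `|Du|²_F = |curl u|² + tr((Du)²)`), so
«harmonic head on a window» is a door observable of the family's second-order template.  This file proves the
PROFILE side:

* `laplacian_head_eq` — `Δ(p + |u|²/2) = ⟪u, Δu⟫ + |curl u|²` for classical solutions (open time set, any `ν`);
* `fderiv_head_eq_zero` — for a profile of the Type-I class with `⟪v(s), Δv(s)⟫ + |curl v(s)|² ≡ 0` on a slice and any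
  window pressure, `∇(p + |v|²/2)(s) ≡ 0`: the head is harmonic with mean oscillation `≤ (K + ½)C²/(−s)·|B̄|` on all
  balls of radius `≥ 1` ((F1) `exists_integral_abs_sub_le_class` for `p`, the rate for `|v|²/2`), hence has vanishing
  gradient (`…HarmonicOscillation.fderiv_eq_zero_of_harmonic_of_oscillation`);
* `eq_zero_of_headSource_eq_zero` — **such profiles vanish identically** (then the head is constant along streamlines:
  w1's `eq_zero_of_head_streamline`; `|v|²` is a heat sub-solution);
* `analyticOnNhd_headSource_slice`, `headSourceWindowToSlab`, **`harmonicHeadWindowRigidity`** — the WINDOW form in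
  door-crux shape: `⟪v, Δv⟫ + |curl v|² = 0` on a nonempty open window of every slice `s < 0` ⇒ not backward-singular.

At the profile level this contains door S12's crux (Beltrami window, `ω × v = 0` ⇒ `div(v × ω) = 0`) and w1's
Bernoulli stratum; the DOOR (second-order zoom + Fatou) is the sequel file `…LocalTraceTubeDoorHarmonicHeadTarget`.

WHAT THIS IS NOT: not a claim about Navier–Stokes regularity (Clay A) — the profile-rigidity half of a local
regularity CRITERION conditional on local Type I («Type-I blow-up needs a non-harmonic Bernoulli head — a Lamb vector
with non-zero divergence — on every similarity window»); establishment in the cell's sense still requires the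
cross-family referee PASS + independent reproduction.
-/

noncomputable section

-- the summit and its single sub-problem share the name (CONVENTIONS §1), as in every Theorems file
set_option linter.dupNamespace false

namespace Summit.NavierStokesRegularity.NavierStokesRegularity.Theorems.LocalTraceTubeDoorHarmonicHead

open MeasureTheory Set Function Filter Topology TopologicalSpace Metric InnerProductSpace
open scoped RealInnerProductSpace InnerProductSpace Laplacian ContDiff
open Literature.Analysis Literature.Analysis.FluidPDE
open Summit.NavierStokesRegularity.NavierStokesRegularity.Theorems.LocalTraceTubeDoorHarmonicOscillation
open Summit.NavierStokesRegularity.NavierStokesRegularity.Theorems.LocalHelicityTubeDoorFrobeniusProfileRigidityBernoulli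
open Summit.NavierStokesRegularity.NavierStokesRegularity.Theorems.LocalHelicityTubeDoorFrobeniusWindowRigidityWindow
open Summit.NavierStokesRegularity.NavierStokesRegularity.Theorems.LocalSineTubeDoorProfileAlignedWindowRigidityAncient
open Summit.NavierStokesRegularity.NavierStokesRegularity.Theorems.PoloidalWindowDoorPoloidalWindowRigidityWindow
open Summit.NavierStokesRegularity.NavierStokesRegularity.Theorems.PoloidalWindowDoorPoloidalWindowRigidityFlat
open Summit.NavierStokesRegularity.NavierStokesRegularity.Theorems.PoloidalWindowDoorPoloidalWindowRigidityPressureOscillation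

/-! ### the Laplacian of the Bernoulli head -/

/-- **`Δ(p + |u|²/2) = ⟪u, Δu⟫ + |curl u|²`** for a classical solution `(u, p)` of the unforced Navier–Stokes system on
an open time set (any viscosity): pressure Poisson `Δp = −tr((Du)²)`, `Δ|u|² = 2⟪Δu, u⟫ + 2|Du|²_F` and
`|Du|²_F = |curl u|² + tr((Du)²)`. -/
theorem laplacian_head_eq {S : Set ℝ} (hSo : IsOpen S) {ν : ℝ}
    {u : ℝ → EuclideanSpace ℝ (Fin 3) → EuclideanSpace ℝ (Fin 3)} {p : ℝ → EuclideanSpace ℝ (Fin 3) → ℝ}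
    (hns : IsClassicalNSSolutionOn S ν 0 u p) {t : ℝ} (ht : t ∈ S) (x : EuclideanSpace ℝ (Fin 3)) :
    (Δ (fun y => p t y + (2 : ℝ)⁻¹ * ⟪u t y, u t y⟫_ℝ)) x = ⟪u t x, (Δ (u t)) x⟫_ℝ + ‖curl (u t) x‖ ^ 2 := by
  have htI : t ∈ interior S := by rw [hSo.interior_eq]; exact ht
  have hu2 : ContDiff ℝ 2 (u t) := contDiff_infty.1 (hns.contDiff_velocity ht) 2
  have hp2 : ContDiff ℝ 2 (p t) := contDiff_infty.1 (hns.contDiff_pressure ht) 2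
  have hq2 : ContDiff ℝ 2 (fun y => ⟪u t y, u t y⟫_ℝ) := hu2.inner ℝ hu2
  have hq2' : ContDiff ℝ 2 (fun y => (2 : ℝ)⁻¹ * ⟪u t y, u t y⟫_ℝ) := contDiff_const.mul hq2
  -- Laplacian of the sum and of the scalar multiple
  have hadd : (Δ (fun y => p t y + (2 : ℝ)⁻¹ * ⟪u t y, u t y⟫_ℝ)) x =
      (Δ (p t)) x + (Δ (fun y => (2 : ℝ)⁻¹ * ⟪u t y, u t y⟫_ℝ)) x := by
    have e : (fun y => p t y + (2 : ℝ)⁻¹ * ⟪u t y, u t y⟫_ℝ) = (p t) + fun y => (2 : ℝ)⁻¹ * ⟪u t y, u t y⟫_ℝ := rfl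
    rw [e, (hp2.contDiffAt).laplacian_add hq2'.contDiffAt]
  have hsm : (Δ (fun y => (2 : ℝ)⁻¹ * ⟪u t y, u t y⟫_ℝ)) x = (2 : ℝ)⁻¹ * (Δ (fun y => ⟪u t y, u t y⟫_ℝ)) x := by
    have e : (fun y => (2 : ℝ)⁻¹ * ⟪u t y, u t y⟫_ℝ) = (2 : ℝ)⁻¹ • fun y => ⟪u t y, u t y⟫_ℝ := by
      funext y; simp [smul_eq_mul]
    rw [e, InnerProductSpace.laplacian_smul _ hq2.contDiffAt, smul_eq_mul]
  -- pressure Poisson, `Δ|u|²`, and the Frobenius identity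
  have hP : (Δ (p t)) x = -traceCLM ((fderiv ℝ (u t) x).comp (fderiv ℝ (u t) x)) := by
    rw [laplacian_pressure_eq_of_isClassicalNSSolutionOn hns htI x,
      divergence_convect_self_eq hu2 (hns.divFree t ht) x]
    have h0 : VectorCalculus.divergence ((0 : ℝ → EuclideanSpace ℝ (Fin 3) → EuclideanSpace ℝ (Fin 3)) t) x = 0 := by
      rw [divergence_eq_traceCLM]; simp
    rw [h0, add_zero]
  have hL : (Δ (fun y => ⟪u t y, u t y⟫_ℝ)) x =
      2 * ⟪(Δ (u t)) x, u t x⟫_ℝ + 2 * frobeniusNormSq (fderiv ℝ (u t) x) := laplacian_inner_self_eq hu2 x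
  have hF := frobeniusNormSq_fderiv_eq_sq_norm_curl_add_trace (u t) x
  rw [hadd, hsm, hP, hL, hF, real_inner_comm (u t x)]
  ring

/-! ### the class: profiles with harmonic head -/

variable {C : ℝ} {v : ℝ → EuclideanSpace ℝ (Fin 3) → EuclideanSpace ℝ (Fin 3)}

/-- **The head of a profile with `⟪v, Δv⟫ + |curl v|² ≡ 0` on a slice has vanishing gradient on that slice**: it is
harmonic (`laplacian_head_eq`) with mean oscillation `≤ (K + ½)·C²/(−s)·|B̄(y,r)|` on every ball of radius `r ≥ 1`
((F1) for the pressure, the Type-I rate for `|v|²/2`), so `fderiv_eq_zero_of_harmonic_of_oscillation` applies. -/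
theorem fderiv_head_eq_zero (hrate : HasTypeITimeDecay C v)
    (hmild : ∀ s t : ℝ, s < t → t < 0 → ∀ x,
      v t x = UnboundedOperators.heatExtension (v s) (t - s) x - oseenDuhamel 1 s v v t x)
    {t₀ : ℝ} (ht₀ : t₀ < 0) {p : ℝ → EuclideanSpace ℝ (Fin 3) → ℝ}
    (hcl : IsClassicalNSSolutionOn (Ioo t₀ 0) 1 0 v p) {s : ℝ} (hs : s ∈ Ioo t₀ 0)
    (hH : ∀ y : EuclideanSpace ℝ (Fin 3), ⟪v s y, (Δ (v s)) y⟫_ℝ + ‖curl (v s) y‖ ^ 2 = 0)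
    (y : EuclideanSpace ℝ (Fin 3)) :
    fderiv ℝ (fun z => p s z + (2 : ℝ)⁻¹ * ⟪v s z, v s z⟫_ℝ) y = 0 := by
  have hs0 : 0 < -s := by linarith [hs.2]
  have hv2 : ContDiff ℝ 2 (v s) := contDiff_infty.1 (hcl.contDiff_velocity hs) 2
  have hp2 : ContDiff ℝ 2 (p s) := contDiff_infty.1 (hcl.contDiff_pressure hs) 2
  have hHead2 : ContDiff ℝ 2 (fun z => p s z + (2 : ℝ)⁻¹ * ⟪v s z, v s z⟫_ℝ) :=
    hp2.add (contDiff_const.mul (hv2.inner ℝ hv2))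
  -- harmonic
  have hharm : HarmonicOnNhd (fun z => p s z + (2 : ℝ)⁻¹ * ⟪v s z, v s z⟫_ℝ) univ :=
    harmonicOnNhd_of_laplacian_eq_zero hHead2 fun x => by rw [laplacian_head_eq isOpen_Ioo hcl hs x, hH x]
  -- mean oscillation on balls of radius `≥ 1`
  obtain ⟨K, hK0, hF1⟩ := exists_integral_abs_sub_le_class
  have hC2 : 0 ≤ C ^ 2 / (-s) := div_nonneg (sq_nonneg C) hs0.le
  set M : ℝ := (K + 2⁻¹) * (C ^ 2 / (-s)) with hM
  have hM0 : 0 ≤ M := mul_nonneg (by positivity) hC2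
  have hqbd : ∀ z, (2 : ℝ)⁻¹ * ⟪v s z, v s z⟫_ℝ ≤ 2⁻¹ * (C ^ 2 / (-s)) := fun z => by
    refine mul_le_mul_of_nonneg_left ?_ (by norm_num)
    rw [real_inner_self_eq_norm_sq]
    have h1 := hrate s hs.2 z
    have h2 : ‖v s z‖ ^ 2 ≤ (C / Real.sqrt (-s)) ^ 2 := pow_le_pow_left₀ (norm_nonneg _) h1 2
    rwa [div_pow, Real.sq_sqrt hs0.le] at h2
  have hq0 : ∀ z, 0 ≤ (2 : ℝ)⁻¹ * ⟪v s z, v s z⟫_ℝ := fun z => mul_nonneg (by norm_num) real_inner_self_nonneg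
  have hosc : ∀ r : ℝ, 1 ≤ r → ∃ κ : ℝ, ∫ w in closedBall y r,
      |(p s w + (2 : ℝ)⁻¹ * ⟪v s w, v s w⟫_ℝ) - κ| ≤ M * volume.real (closedBall y r) := by
    intro r hr
    obtain ⟨κ, hκ⟩ := hF1 hrate hmild ht₀ hcl s hs y r hr
    refine ⟨κ, ?_⟩
    have hcomp : IsCompact (closedBall y r) := isCompact_closedBall _ _
    have hpc : Continuous fun w => |p s w - κ| := ((hp2.continuous).sub continuous_const).abs
    have hHeadc : Continuous fun w => |(p s w + (2 : ℝ)⁻¹ * ⟪v s w, v s w⟫_ℝ) - κ| :=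
      ((hHead2.continuous).sub continuous_const).abs
    have hpt : ∀ w, |(p s w + (2 : ℝ)⁻¹ * ⟪v s w, v s w⟫_ℝ) - κ| ≤ |p s w - κ| + 2⁻¹ * (C ^ 2 / (-s)) := by
      intro w
      have e : (p s w + (2 : ℝ)⁻¹ * ⟪v s w, v s w⟫_ℝ) - κ = (p s w - κ) + (2 : ℝ)⁻¹ * ⟪v s w, v s w⟫_ℝ := by ring
      rw [e]
      calc |(p s w - κ) + (2 : ℝ)⁻¹ * ⟪v s w, v s w⟫_ℝ| ≤ |p s w - κ| + |(2 : ℝ)⁻¹ * ⟪v s w, v s w⟫_ℝ| :=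
            abs_add_le _ _
        _ = |p s w - κ| + (2 : ℝ)⁻¹ * ⟪v s w, v s w⟫_ℝ := by rw [abs_of_nonneg (hq0 w)]
        _ ≤ |p s w - κ| + 2⁻¹ * (C ^ 2 / (-s)) := by linarith [hqbd w]
    have hvol : volume (closedBall y r) < ⊤ := hcomp.measure_lt_top
    calc ∫ w in closedBall y r, |(p s w + (2 : ℝ)⁻¹ * ⟪v s w, v s w⟫_ℝ) - κ|
        ≤ ∫ w in closedBall y r, (|p s w - κ| + 2⁻¹ * (C ^ 2 / (-s))) := by
          refine setIntegral_mono_on (hHeadc.continuousOn.integrableOn_compact hcomp)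
            ((hpc.continuousOn.integrableOn_compact hcomp).add (integrableOn_const hvol.ne))
            measurableSet_closedBall fun w _ => hpt w
      _ = (∫ w in closedBall y r, |p s w - κ|) + 2⁻¹ * (C ^ 2 / (-s)) * volume.real (closedBall y r) := by
          rw [integral_add (hpc.continuousOn.integrableOn_compact hcomp) (integrableOn_const hvol.ne),
            setIntegral_const, smul_eq_mul, mul_comm (volume.real _)]
      _ ≤ K * (C ^ 2 / (-s)) * volume.real (closedBall y r) +
            2⁻¹ * (C ^ 2 / (-s)) * volume.real (closedBall y r) := by linarith [hκ]
      _ = M * volume.real (closedBall y r) := by rw [hM]; ring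
  exact fderiv_eq_zero_of_harmonic_of_oscillation hharm y hM0 hosc

/-- **TYPE-I PROFILES WITH HARMONIC HEAD ARE TRIVIAL**: if `⟪v(s,y), Δv(s)(y)⟫ + |curl v(s)(y)|² = 0` at every
point of every slice `s < 0`, then `v ≡ 0` — the head has vanishing gradient on every slice (`fderiv_head_eq_zero`),
in particular it is constant along streamlines, and w1's Bernoulli Liouville `eq_zero_of_head_streamline` concludes. -/
theorem eq_zero_of_headSource_eq_zero (hrate : HasTypeITimeDecay C v)
    (hcont : ContinuousOn (uncurry v) (Iio (0 : ℝ) ×ˢ univ))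
    (hmild : ∀ s t : ℝ, s < t → t < 0 → ∀ x,
      v t x = UnboundedOperators.heatExtension (v s) (t - s) x - oseenDuhamel 1 s v v t x)
    (hdiv : ∀ t < 0, VectorCalculus.IsDivFree (v t))
    (hH : ∀ s < 0, ∀ y : EuclideanSpace ℝ (Fin 3), ⟪v s y, (Δ (v s)) y⟫_ℝ + ‖curl (v s) y‖ ^ 2 = 0) :
    ∀ t < 0, ∀ x, v t x = 0 := by
  have hA : IsTypeIAncientMild C v := isTypeIAncientMild_of_class hrate hcont hmild hdiv
  refine eq_zero_of_head_streamline hrate hcont hmild hdiv fun s hs => ?_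
  have ht₀ : s - 1 < 0 := by linarith
  have hsI : s ∈ Ioo (s - 1) 0 := ⟨by linarith, hs⟩
  obtain ⟨p, hcl⟩ := hA.exists_isClassicalNSSolutionOn_Ioo ht₀
  refine ⟨s - 1, by linarith, p, hcl, fun y => ?_⟩
  have hv2 : ContDiff ℝ 2 (v s) := contDiff_infty.1 (hcl.contDiff_velocity hsI) 2
  have hp2 : ContDiff ℝ 2 (p s) := contDiff_infty.1 (hcl.contDiff_pressure hsI) 2
  have hvd : DifferentiableAt ℝ (v s) y := (hv2.differentiable (by norm_num)) y
  have hpd : DifferentiableAt ℝ (p s) y := (hp2.differentiable (by norm_num)) y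
  have hqd : DifferentiableAt ℝ (fun z => ⟪v s z, v s z⟫_ℝ) y := hvd.inner ℝ hvd
  have hD := fderiv_head_eq_zero hrate hmild ht₀ hcl hsI (hH s hs) y
  -- read the vanishing derivative along the direction `v(s,y)`
  have h1 : fderiv ℝ (fun z => p s z + (2 : ℝ)⁻¹ * ⟪v s z, v s z⟫_ℝ) y (v s y) =
      fderiv ℝ (p s) y (v s y) + (2 : ℝ)⁻¹ * fderiv ℝ (fun z => ⟪v s z, v s z⟫_ℝ) y (v s y) := by
    rw [fderiv_fun_add hpd (hqd.const_mul _), fderiv_const_mul hqd]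
    rfl
  rw [hD] at h1
  have h2 : fderiv ℝ (fun z => ⟪v s z, v s z⟫_ℝ) y (v s y) = 2 * ⟪v s y, fderiv ℝ (v s) y (v s y)⟫_ℝ := by
    rw [fderiv_inner_apply ℝ hvd hvd (v s y), real_inner_comm (v s y), two_mul]
  have h3 : fderiv ℝ (p s) y (v s y) = ⟪v s y, gradient (p s) y⟫_ℝ := by
    rw [gradient, real_inner_comm, InnerProductSpace.toDual_symm_apply]
  rw [h2, h3] at h1
  rw [show (0 : EuclideanSpace ℝ (Fin 3) →L[ℝ] ℝ) (v s y) = 0 from rfl] at h1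
  rw [convect_apply]
  linarith

/-- **The harmonic-head stratum of the family's profile class is settled**: such a profile is not backward-singular. -/
theorem not_backwardSingular_of_headSource_eq_zero (hrate : HasTypeITimeDecay C v)
    (hcont : ContinuousOn (uncurry v) (Iio (0 : ℝ) ×ˢ univ))
    (hmild : ∀ s t : ℝ, s < t → t < 0 → ∀ x,
      v t x = UnboundedOperators.heatExtension (v s) (t - s) x - oseenDuhamel 1 s v v t x)
    (hdiv : ∀ t < 0, VectorCalculus.IsDivFree (v t))
    (hH : ∀ s < 0, ∀ y : EuclideanSpace ℝ (Fin 3), ⟪v s y, (Δ (v s)) y⟫_ℝ + ‖curl (v s) y‖ ^ 2 = 0) :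
    ¬ IsBackwardSingularPoint v 0 :=
  not_backwardSingular_of_zero (eq_zero_of_headSource_eq_zero hrate hcont hmild hdiv hH)

/-! ### window → slab for the head source -/

/-- **The Laplacian `y ↦ Δw(y)` of a real-analytic field is real-analytic** (trace of the analytic second
derivative in the standard orthonormal basis). -/
theorem analyticOnNhd_laplacian {w : EuclideanSpace ℝ (Fin 3) → EuclideanSpace ℝ (Fin 3)}
    (hw : AnalyticOnNhd ℝ w univ) : AnalyticOnNhd ℝ (fun y => (Δ w) y) univ := by
  set b := stdOrthonormalBasis ℝ (EuclideanSpace ℝ (Fin 3)) with hb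
  have h2 : AnalyticOnNhd ℝ (iteratedFDeriv ℝ 2 w) univ := hw.iteratedFDeriv 2
  have hterm : ∀ i, AnalyticOnNhd ℝ (fun y => iteratedFDeriv ℝ 2 w y ![b i, b i]) univ := by
    intro i y hy
    exact ((ContinuousMultilinearMap.apply ℝ (fun _ : Fin 2 => EuclideanSpace ℝ (Fin 3)) (EuclideanSpace ℝ (Fin 3))
      ![b i, b i]).analyticAt _).comp (h2 y hy)
  have hsum : AnalyticOnNhd ℝ (fun y => ∑ i, iteratedFDeriv ℝ 2 w y ![b i, b i]) univ := by
    have h := Finset.analyticOnNhd_sum Finset.univ fun i _ => hterm i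
    refine AnalyticOnNhd.congr isOpen_univ h fun y _ => ?_
    simp only [Finset.sum_apply]
  have e : (fun y => (Δ w) y) = fun y => ∑ i, iteratedFDeriv ℝ 2 w y ![b i, b i] := by
    funext y
    rw [InnerProductSpace.laplacian_eq_iteratedFDeriv_stdOrthonormalBasis]
  rw [e]
  exact hsum

/-- **The head source `y ↦ ⟪v(s,y), Δv(s)(y)⟫ + |curl v(s)(y)|²` of a slice of a profile of the class is
real-analytic.** -/
theorem analyticOnNhd_headSource_slice (hrate : HasTypeITimeDecay C v)
    (hcont : ContinuousOn (uncurry v) (Iio (0 : ℝ) ×ˢ univ))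
    (hmild : ∀ s t : ℝ, s < t → t < 0 → ∀ x,
      v t x = UnboundedOperators.heatExtension (v s) (t - s) x - oseenDuhamel 1 s v v t x)
    {s : ℝ} (hs : s < 0) :
    AnalyticOnNhd ℝ (fun y => ⟪v s y, (Δ (v s)) y⟫_ℝ + ‖curl (v s) y‖ ^ 2) univ := by
  have hslice := analyticOnNhd_slice hcont (bdd_of_hasTypeITimeDecay hrate) hmild hs
  have hcurl := analyticOnNhd_curl hslice
  have h1 : AnalyticOnNhd ℝ (fun y => ⟪v s y, (Δ (v s)) y⟫_ℝ) univ := analyticOnNhd_inner hslice (analyticOnNhd_laplacian hslice)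
  have h2 : AnalyticOnNhd ℝ (fun y => ‖curl (v s) y‖ ^ 2) univ := by
    have h := analyticOnNhd_inner hcurl hcurl
    exact AnalyticOnNhd.congr isOpen_univ h fun y _ => real_inner_self_eq_norm_sq _
  exact h1.add h2

/-- **Window → slab for the head source**: for a profile of the class, vanishing of `⟪v, Δv⟫ + |curl v|²` on a
nonempty open window of every slice spreads to every slice (identity theorem). -/
theorem headSourceWindowToSlab (hrate : HasTypeITimeDecay C v)
    (hcont : ContinuousOn (uncurry v) (Iio (0 : ℝ) ×ˢ univ))
    (hmild : ∀ s t : ℝ, s < t → t < 0 → ∀ x,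
      v t x = UnboundedOperators.heatExtension (v s) (t - s) x - oseenDuhamel 1 s v v t x)
    (hwin : ∀ s < 0, ∃ U : Set (EuclideanSpace ℝ (Fin 3)), IsOpen U ∧ U.Nonempty ∧
      ∀ y ∈ U, ⟪v s y, (Δ (v s)) y⟫_ℝ + ‖curl (v s) y‖ ^ 2 = 0) :
    ∀ s < 0, ∀ y : EuclideanSpace ℝ (Fin 3), ⟪v s y, (Δ (v s)) y⟫_ℝ + ‖curl (v s) y‖ ^ 2 = 0 := by
  intro s hs
  obtain ⟨U, hU, hne, hal⟩ := hwin s hs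
  exact real_eq_zero_spread (analyticOnNhd_headSource_slice hrate hcont hmild hs) hU hne hal

/-- **THE PROFILE WINDOW CRUX OF THE HARMONIC-HEAD DOOR, PROVED**: a profile of the family's Type-I class on which
`⟪v(s), Δv(s)⟫ + |curl v(s)|²` — the Laplacian of the Bernoulli head, the divergence of the Lamb vector `v × ω` —
vanishes on a nonempty open window of every slice `s < 0` is not backward-singular at the apex. -/
theorem harmonicHeadWindowRigidity :
    ∀ (C : ℝ) (v : ℝ → EuclideanSpace ℝ (Fin 3) → EuclideanSpace ℝ (Fin 3)),
      Literature.Analysis.FluidPDE.HasTypeITimeDecay C v →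
      ContinuousOn (Function.uncurry v) (Set.Iio (0 : ℝ) ×ˢ Set.univ) →
      (∀ s t : ℝ, s < t → t < 0 → ∀ x, v t x =
        Literature.Analysis.UnboundedOperators.heatExtension (v s) (t - s) x -
          Literature.Analysis.FluidPDE.oseenDuhamel 1 s v v t x) →
      (∀ t < 0, Literature.Analysis.FluidPDE.VectorCalculus.IsDivFree (v t)) →
      (∀ s < 0, ∃ U : Set (EuclideanSpace ℝ (Fin 3)), IsOpen U ∧ U.Nonempty ∧
        ∀ y ∈ U, ⟪v s y, (Δ (v s)) y⟫_ℝ + ‖Literature.Analysis.FluidPDE.curl (v s) y‖ ^ 2 = 0) →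
      ¬ Literature.Analysis.FluidPDE.IsBackwardSingularPoint v 0 := by
  intro C v hrate hcont hmild hdiv hwin
  exact not_backwardSingular_of_headSource_eq_zero hrate hcont hmild hdiv (headSourceWindowToSlab hrate hcont hmild hwin)

end Summit.NavierStokesRegularity.NavierStokesRegularity.Theorems.LocalTraceTubeDoorHarmonicHead

end
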